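import Mathlib
import Literature.Barriers.PneNP.MonotoneGap

/-!
# Relabelling invariance of the perfect matching function
(stub `stub_pmInvariant` of line `Sketch`, crux `RazWigdersonMatching`)

The bipartite perfect matching function `PM_n` (`Literature.Barriers.PneNP.perfectMatchingFn`:
`PM_n z = 1` iff some permutation `σ` has `z (i, σ i) = 1` for all `i`) is invariant under
independent relabellings of rows (`α`) and columns (`β`): the relabelled matrix
`c ↦ z (α c.1, β c.2)` has a perfect matching iff `z` has one. A matching `σ` of the relabelled
matrix is transported to the matching `β ∘ σ ∘ α⁻¹` of `z`, and a matching `σ'` of `z` is pulled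
back to the matching `β⁻¹ ∘ σ' ∘ α` of the relabelled matrix. This is the invariance hypothesis
fed to the planted symmetrisation step of the Raz–Wigderson argument.
-/

set_option linter.dupNamespace false

namespace Summit.ValiantsHypothesis.ValiantsHypothesis.Theorems.ShallowShadowsRazWigdersonMatching

open Literature.Barriers.PneNP

/-- One direction of the invariance, stated for arbitrary relabellings: a perfect matching of
the relabelled matrix `c ↦ z (α c.1, β c.2)` yields a perfect matching of `z`
(transport `σ ↦ β ∘ σ ∘ α⁻¹`). -/
private theorem pm_of_pm_relabel (n : ℕ) (α β : Equiv.Perm (Fin n))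
    (z : Fin n × Fin n → Bool)
    (h : perfectMatchingFn n (fun c => z (α c.1, β c.2)) = true) :
    perfectMatchingFn n z = true := by
  obtain ⟨σ, hσ⟩ := (perfectMatchingFn_eq_true_iff n _).1 h
  refine (perfectMatchingFn_eq_true_iff n z).2 ⟨α.symm.trans (σ.trans β), fun j => ?_⟩
  have := hσ (α.symm j)
  simpa only [Equiv.trans_apply, Equiv.apply_symm_apply] using this

/-- **Relabelling invariance of `PM_n`.** For all row/column relabellings `α, β ∈ S_n` and every
`n × n` Boolean matrix `z`, the relabelled matrix `c ↦ z (α c.1, β c.2)` has a perfect matching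
iff `z` does, i.e. `perfectMatchingFn n (z ∘ (α × β)) = perfectMatchingFn n z`. -/
theorem stub_pmInvariant :
    ∀ (n : ℕ) (α β : Equiv.Perm (Fin n)) (z : Fin n × Fin n → Bool),
      perfectMatchingFn n (fun c => z (α c.1, β c.2)) = perfectMatchingFn n z := by
  intro n α β z
  rw [Bool.eq_iff_iff]
  constructor
  · exact pm_of_pm_relabel n α β z
  · intro hz
    -- pull back along `(α⁻¹, β⁻¹)`: relabelling `c ↦ z (α c.1, β c.2)` by `(α⁻¹, β⁻¹)` gives `z`
    refine pm_of_pm_relabel n α.symm β.symm (fun c => z (α c.1, β c.2)) ?_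
    simpa only [Equiv.apply_symm_apply, Prod.mk.eta] using hz

end Summit.ValiantsHypothesis.ValiantsHypothesis.Theorems.ShallowShadowsRazWigdersonMatching
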